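import Summits.QuantumFields.YangMills.Theorems.BalabanUVNodesN11AllStepsQuadSlot
import Summits.QuantumFields.YangMills.Theorems.BalabanUVNodesN21StepWeightsPositivity

/-!
# DAG node N11 ∕ key K1⁹ — K1⁹'s (B)-FACE CONJUNCT `B16.Thm1Printed` («the densities `ρ_k`, `k ≤ K`, have the §2 [III] form with its bounds») HOLDS BY FIAT MODULO SUPPORTS: the 𝐒-laws
# `SLaw₁₃CoPH θ p (k+1)` read the post-𝐑 densities against the SAME value-free residual slots as the 𝐓-laws, so the companion's switch-and-dial (target := `ρ_{k+1}(s)` instead of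
# `(𝐓ρ_k)(s)`, ZERO terms) serves them; next to every `θ`, inside K1⁹'s hypothesis class, with the SAME densities ∕ flow ∕ β-functions, `Thm1Printed (datumOfRecord₁₃SepCoPH θ′ h′).C` follows
# from the signs and per-history SUPPORT conditions alone — the director's question №292 (1)(d) answered in the kernel: the vacuity is NOT confined to the N11 consumer side (count-neutral, LOCATED)

HEADER — WORK-UNIT METADATA.  Cell `pub-ymgap`, YM-PLAN Track A (HUMAN RULING D-0062), seat `pub-ymgap-dag-n11-d` (g34; N11 [B14], s2), route `BalabanUVNodes`, item K1⁹ =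
stmt-QuantumFields-27364 (helper lane, `--kind proof --supports 27364 --as helper`, count-neutral).  [III] = [Balaban1988Convergent], [IV] = [Balaban1989LargeFieldI], [V] =
[Balaban1989LargeFieldII].  Over this seat's `…N11AllStepsQuadSlot` (g34: ★★ `sect2Slot_succ_mul`, the `repinTop` rows — FLAG №15's kernel certificates, director-ym №292), `…TopPairQuadSlot`
∕ `…K1Hypotheses` (the `sameR` transports), dag-n21-c's `zetaOfRecord_nonneg`, K0's `slotsOfRecord_nonneg`, 11c (`Sect2.lawsRT_towerOfTerms_zero`), RECORD 13 v1.7∕v1.8 `H`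
(`sLaw₁₃CoPH_iff`, `sLaw₁₃CoPH_zero`, `sect2Form_stage13SepCoPH_iff`, `settingOfRecord₁₃_satisfiesRG`, `datumOfRecord₁₃SepCoPH`; `thm1Printed_datumOfRecord₁₃SepCoPHV_iff` = version-free),
[V] (`B16.Thm1Printed C := ∃ γ > 0, ∀ P, (C P).flow.InInterval γ P.K → ∀ k ≤ P.K, (C P).Sect2Form k`).

WHY ∕ WHAT.  Director-ym №292 (1)(d) asks whether K1⁹'s `∃θ` statement AS TYPED (v10) acquires vacuity from the value-free residual rows, or whether the by-fiat rows are confined to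
the N11 consumer side.  K1⁹'s consequent carries `B16.EndStatementBPrinted (datum).C = Thm1Printed ∧ Cor3_250`; `Thm1Printed` is «∀ k ≤ K, Sect2Form k» and `Sect2Form k ↔
SLaw₁₃CoPH θ P k` (`sect2Form_stage13SepCoPH_iff` ∘ `sLaw₁₃CoPH_iff`) — the §2 form of the POST-𝐑 density `ρ_k = slotsOfRecord … k` over the weights `WtOfRecord₁₃H θ P s` of the
histories of length `k`, i.e. over the SAME residual slots `Zh P k` that serve the 𝐓-law `TLaw₁₃CoPH θ P (k−1)`.  §1 ★★★ `target_eq_sect2Slot_of_switch_dial` (the companion's switch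
and dial hit ANY nonnegative target `T(V_{k+1})` whose support lies a.e. inside the reference new side's) · `slotsOfRecord_nonneg_of_provisos₁₃CoPH`.  §2 ★★★★★
`exists_zh_allSteps_sLaw_zeroTerms_of_supports`: next to every `θ` a `θ′` (same `Stage13RParams` ∕ `Phih`; residuals unchanged below the top generation; rows transferred) with, for every
run and every `k`: signs + `0 ≤ g_j` + (i) `0 ≤ ρ_{k+1}` + (ii) per history a.e. on the `χ_{k+1}(s)`-support «`0 < ρ_{k+1}(s) → 0 < J⁰_p(s)`» ⟹ `SLaw₁₃CoPH θ′ p (k+1)` (ZERO terms; the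
inductive bounds `Sect2.LawsRT (k+1)` met by 11c's `lawsRT_towerOfTerms_zero`; `SLaw 0` is a theorem).  §3 ★★★★★★ `exists_thm1Printed_datum_by_fiat_of_supports_of_hypotheses`: from ANY `θ`
in K1⁹'s hypothesis class a `θ′ h′` IN THE SAME CLASS, same `Stage13RParams` (so the same `ρ_k`, flow, β, observables, (0.1) faces), such that for EVERY `γ > 0` the signs and the
per-history support conditions along the runs of the `γ`-window give `B16.Thm1Printed (datumOfRecord₁₃SepCoPH F N θ′ h′).C`.  ANSWER TO №292 (1)(d), LOCATED: the vacuity is NOT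
confined to the N11 consumer side — K1⁹'s (B) face reads the 𝐒-laws through the same value-free slots; what K1⁹ v10 genuinely asks is the antecedent's inhabitation (K0), the per-history
SUPPORT conditions (def-T's densities vs 11a's new sides), `Cor3_250` ∕ (0.1) (the UV bounds on `ρ_k` — 𝐑-data, untouched by any residual), and the flow ∕ β ∕ continuity conjuncts;
the §2 DESCRIPTION of [III]∕[V] Thm 1 (form (2.18) with the bounds (2.27)–(2.31), (2.42)) carries no weight until C2 and the ζ0 VALUE pin land (FLAG №15's cure of record).

HONEST FRAMING.  A READING on the tree's own rows and objects (count-neutral, LOCATED): nothing of Bałaban asserted or refuted; the support conditions are NOT claimed at any `θ`; K1⁹'s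
`∃θ` NOT advanced and NOT refuted — NO K1⁹ witness is produced (the antecedent is not inhabited here, `Cor3_250`, the window ∕ flow ∕ β ∕ continuity conjuncts and the supports are
untouched); no `Stage13HParams` of record constructed or modified (anonymous-constructor inhabitation next to an arbitrary `θ`); N11 NOT discharged; K1⁹ NOT closed; no registered stub
touched; counts unmoved (typed 28∕28 · discharged 8∕27).  One finite four-torus programme at fixed `ε = L^{−K}`; NOT ℝ⁴, NOT OS, NOT a mass gap, NOT Clay.  No `sorry`, `axiom`, `def`,
`instance`, `notation`.  Sources (SHAPE only): [V] Thm 1 p.355; [III] Thm 1 p.262, (2.17)–(2.18) p.257, (2.21)–(2.23) p.258, (2.27)–(2.31) pp.259–260, (2.42) p.261, (3.23)–(3.25) p.270;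
[IV] (0.2)–(0.4) pp.176–177.
-/

noncomputable section

open MeasureTheory
open scoped BigOperators Matrix.Norms.L2Operator

namespace Summit.QuantumFields.YangMills.Theorems.BalabanUVNodesN11K1BFaceSect2FormBySupports

open Literature.MathematicalPhysics.QuantumFieldTheory.Balaban1983to89 T4Continuum Node00 Node00.Tk B14.Eq218Concrete B14.Sect3Decomp
open BalabanUVNodesN11TopPairLocalResidual (WtOfRecord₁₃H_ζ_eq_ζ0)
open BalabanUVNodesN11TopPairQuadSlotK1Hypotheses (provisos₁₃SepCoPH_of_sameR slotsNondegenerate₁₃_of_sameR admissible_of_sameR)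
open BalabanUVNodesN11AllStepsQuadSlot (sect2Slot_succ_mul zhLocal_of_repinTop zhLaws_of_repinTop zhUnity_of_repinTop)
open N21StepWeightsPositivity (zetaOfRecord_nonneg)

variable {F : T4Family} {N : ℕ} [NeZero N]

/-! ## §1. The switch and the dial hit ANY prescribed nonnegative target whose support lies inside the reference new side's -/

section Target

variable (θ : Stage13HParams F N) (p : B12.RunParams)

/-- ★★★ **THE SWITCH-AND-DIAL IDENTITY FOR AN ARBITRARY TARGET** (step `k → k+1`, child `s`, any terms): weight data agreeing with `θ`'s below generation `k`, with generation-`k`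
`ζ`-factor on `Ω_{k+1}ᶜ` equal to `𝟙{0 < T(V_{k+1}) ∧ 0 < J(V_{k+1})}` and generation-`k` A-weights `e^{−½c(V_{k+1})}` times `θ`'s, `c = 2·log(J∕T)`, give `T(V) = ` NEW SIDE at every `V` with
`0 ≤ T(V)` and `0 < T(V) → 0 < J(V)` — for ANY function `T` of the new field (`J` = `θ`'s own new side with the generation-`k` residual factor set to `1`).  The companion's
`slotsT_succ_eq_sect2Slot_of_switch_dial` is the case `T = (𝐓ρ_k)(s)`; below `T = ρ_{k+1}(s)`, the POST-𝐑 slot. [cite: Balaban1988Convergent, (2.18) p.257, (2.21)–(2.23) p.258, (3.23)–(3.25) p.270 (bookkeeping)] -/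
theorem target_eq_sect2Slot_of_switch_dial {k : ℕ} (s : SeqOfRecord F θ.ν θ.τ9.M (gOfRecord₁₃ F N θ.toStage13Params p) p.K (k + 1))
    (u₁ : Sect2.TermValues (F.P p.K) (MatA N) (FluctV N) θ.τ9.M) (e₁ : ℝ) (W' : TkWeights F N (FluctV N) p.K) (T c : GaugeField (F.P p.K) (k + 1) (SU N) → ℝ)
    (hζlt : ∀ j, j < k → W'.ζ j (s.Ω (j + 1))ᶜ = (WtOfRecord₁₃H F N θ p s).ζ j (s.Ω (j + 1))ᶜ)
    (hwlt : ∀ j, j < k → ∀ S₁, W'.w j (s.Λ (j + 1)) ((s.Λ (j + 1))ᶜ ∩ s.Ω (j + 1)) S₁ = (WtOfRecord₁₃H F N θ p s).w j (s.Λ (j + 1)) ((s.Λ (j + 1))ᶜ ∩ s.Ω (j + 1)) S₁)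
    (hζ : ∀ ω, W'.ζ k (s.Ω (k + 1))ᶜ ω =
      Set.indicator {V | 0 < T V ∧
        0 < sect2Slot F N (FluctV N) p.K (settingOfRecord₁₃ F N θ.toStage13Params p) (θ.rzAt p s)
          { WtOfRecord₁₃H F N θ p s with ζ := fun j Y ω => if j = k then 1 else (WtOfRecord₁₃H F N θ p s).ζ j Y ω } s u₁ e₁
          (UbgOfRecord₁₃CoP F N θ.toStage13Params p (k + 1) s) V} (1 : GaugeField (F.P p.K) (k + 1) (SU N) → ℝ) (ω (k + 1)).1)
    (hw : ∀ S₁ ω, W'.w k (s.Λ (k + 1)) ((s.Λ (k + 1))ᶜ ∩ s.Ω (k + 1)) S₁ ω =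
      Real.exp (-(1 / 2 : ℝ) * c (ω (k + 1)).1) * (WtOfRecord₁₃H F N θ p s).w k (s.Λ (k + 1)) ((s.Λ (k + 1))ᶜ ∩ s.Ω (k + 1)) S₁ ω)
    (hc : ∀ V, 0 < T V →
      0 < sect2Slot F N (FluctV N) p.K (settingOfRecord₁₃ F N θ.toStage13Params p) (θ.rzAt p s)
          { WtOfRecord₁₃H F N θ p s with ζ := fun j Y ω => if j = k then 1 else (WtOfRecord₁₃H F N θ p s).ζ j Y ω } s u₁ e₁
          (UbgOfRecord₁₃CoP F N θ.toStage13Params p (k + 1) s) V →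
      c V = 2 * Real.log (sect2Slot F N (FluctV N) p.K (settingOfRecord₁₃ F N θ.toStage13Params p) (θ.rzAt p s)
          { WtOfRecord₁₃H F N θ p s with ζ := fun j Y ω => if j = k then 1 else (WtOfRecord₁₃H F N θ p s).ζ j Y ω } s u₁ e₁
          (UbgOfRecord₁₃CoP F N θ.toStage13Params p (k + 1) s) V / T V))
    (V : GaugeField (F.P p.K) (k + 1) (SU N)) (h0 : 0 ≤ T V)
    (hTJ : 0 < T V → 0 < sect2Slot F N (FluctV N) p.K (settingOfRecord₁₃ F N θ.toStage13Params p) (θ.rzAt p s)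
          { WtOfRecord₁₃H F N θ p s with ζ := fun j Y ω => if j = k then 1 else (WtOfRecord₁₃H F N θ p s).ζ j Y ω } s u₁ e₁
          (UbgOfRecord₁₃CoP F N θ.toStage13Params p (k + 1) s) V) :
    T V = sect2Slot F N (FluctV N) p.K (settingOfRecord₁₃ F N θ.toStage13Params p) (θ.rzAt p s) W' s u₁ e₁ (UbgOfRecord₁₃CoP F N θ.toStage13Params p (k + 1) s) V := by
  set Wr : TkWeights F N (FluctV N) p.K := { WtOfRecord₁₃H F N θ p s with ζ := fun j Y ω => if j = k then 1 else (WtOfRecord₁₃H F N θ p s).ζ j Y ω } with hWr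
  set J := sect2Slot F N (FluctV N) p.K (settingOfRecord₁₃ F N θ.toStage13Params p) (θ.rzAt p s) Wr s u₁ e₁ (UbgOfRecord₁₃CoP F N θ.toStage13Params p (k + 1) s) with hJ
  have key := sect2Slot_succ_mul θ.ν θ.τ9.M (gOfRecord₁₃ F N θ.toStage13Params p) p.K s (W := Wr) (W' := W')
    (fun V₁ => Set.indicator {V | 0 < T V ∧ 0 < J V} (1 : GaugeField (F.P p.K) (k + 1) (SU N) → ℝ) V₁) (fun V₁ => Real.exp (-(1 / 2 : ℝ) * c V₁))
    (fun j hj => by rw [hζlt j hj]; exact (funext fun ω => if_neg (Nat.ne_of_lt hj)).symm) (fun j hj S₁ => hwlt j hj S₁)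
    (fun ω => by rw [hζ]; exact (mul_one _).symm.trans (congrArg _ (if_pos rfl).symm)) (fun S₁ ω => hw S₁ ω)
    (settingOfRecord₁₃ F N θ.toStage13Params p) (θ.rzAt p s) u₁ e₁ (UbgOfRecord₁₃CoP F N θ.toStage13Params p (k + 1) s) V
  rw [key]
  by_cases hσ : 0 < T V ∧ 0 < J V
  · rw [Set.indicator_of_mem (show V ∈ {V | 0 < T V ∧ 0 < J V} from hσ), Pi.one_apply, one_mul, hc V hσ.1 hσ.2,
      show -(1 / 2 : ℝ) * (2 * Real.log (J V / T V)) = -Real.log (J V / T V) by ring, Real.exp_neg, Real.exp_log (div_pos hσ.2 hσ.1),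
      inv_div, div_mul_cancel₀ _ hσ.2.ne']
  · have hT0 : ¬ 0 < T V := fun h => hσ ⟨h, hTJ h⟩
    rw [Set.indicator_of_notMem (show V ∉ {V | 0 < T V ∧ 0 < J V} from hσ), zero_mul, zero_mul]
    exact le_antisymm (not_lt.1 hT0) h0

/-- **`0 ≤ ρ_k(s)(V)` FROM THE PROVISO ROWS** `zetaUnity`, `zetaAbs` (K0's `slotsOfRecord_nonneg` at non-negative step weights). [cite: Balaban1988Convergent, (2.18) p.257, (3.24) p.270; Balaban1989LargeFieldI, (0.3) p.176 (bookkeeping)] -/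
theorem slotsOfRecord_nonneg_of_provisos₁₃CoPH (h : θ.Provisos₁₃CoPH F N) {n : ℕ} (s : SeqOfRecord F θ.ν θ.τ9.M (gOfRecord₁₃ F N θ.toStage13Params p) p.K n)
    (V : GaugeField (F.P p.K) n (SU N)) :
    0 ≤ slotsOfRecord F N θ.ν θ.τ9 (EOfRecord₁₃ F N θ.toStage13Params) (wOfRecord₉ F N θ.toStage9Params) θ.ppSel p (gOfRecord₁₃ F N θ.toStage13Params p) n s V :=
  slotsOfRecord_nonneg F N θ.ν θ.τ9 (EOfRecord₁₃ F N θ.toStage13Params)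
    (fun p' g' j s'' U V'' => wOfRecord_nonneg F N θ.ν θ.τ9.M p' g' j θ.A₁ (zetaOfRecord_nonneg F N θ.ν θ.τ9.M h.zetaUnity h.zetaAbs) s'' U V'') θ.ppSel p
    (gOfRecord₁₃ F N θ.toStage13Params p) n s V

end Target

/-! ## §2. The 𝐒-LAWS of the record — the §2 form of the POST-𝐑 densities `ρ_{k+1}` — by fiat modulo supports, ZERO terms, next to every `θ` -/

section SLaws

/-- ★★★★★ **THE 𝐒-LAWS OF THE RECORD HOLD MODULO SUPPORTS WITH ZERO TERMS, NEXT TO EVERY `θ`.**  There is a parameter `θ′` with the SAME `Stage13RParams` data and `Phih` as `θ` (so the SAME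
densities `ρ_k`, flow, β-functions, backgrounds), residuals agreeing with `θ`'s below the top generation of each history length, rows `zhLocal` ∕ `zhLaws` ∕ `ZhUnity` transferred, such that
for every run `p` and every `k`: signs `0 ≤ E₀, B₀` ∧ `0 ≤ g_j` (`j ≤ k+1`) ∧ (i) `0 ≤ ρ_{k+1}(s)` (rows `zetaUnity`∕`zetaAbs`) ∧ (ii) per history `s` of length `k+1`, a.e. on the support of
`χ_{k+1}(s)`, «`0 < ρ_{k+1}(s)(V) → 0 < J⁰_p(s)(V)`» (`J⁰` = `θ`'s own new side at `s`, ZERO terms, constant `e_p`, generation-`k` residual factor set to `1`) ⟹ `SLaw₁₃CoPH θ′ p (k+1)` — the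
§2 [III] form (2.18) of `ρ_{k+1}` WITH the inductive bounds `Sect2.LawsRT (k+1)` (met by the zero terms, 11c's `lawsRT_towerOfTerms_zero`).  `SLaw₁₃CoPH θ′ p 0` is a theorem outright
(`sLaw₁₃CoPH_zero`).  LOCATED, count-neutral; nothing of Bałaban asserted or refuted; (ii) NOT claimed at any `θ`. [cite: Balaban1988Convergent, Thm 1 p.262, (2.17)–(2.18) p.257, (2.21)–(2.23) p.258, (2.27)–(2.31) pp.259–260, (2.42) p.261, (3.23)–(3.25) p.270; Balaban1989LargeFieldI, (0.2)–(0.4) pp.176–177] -/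
theorem exists_zh_allSteps_sLaw_zeroTerms_of_supports (θ : Stage13HParams F N) (e : B12.RunParams → ℝ) :
    ∃ θ' : Stage13HParams F N, θ'.toStage13RParams = θ.toStage13RParams ∧ θ'.Phih = θ.Phih ∧
      (∀ p n Ω Λ j Y ω, j + 1 ≠ n → (θ'.Zh p n Ω Λ).ζ0 j Y ω = (θ.Zh p n Ω Λ).ζ0 j Y ω) ∧
      (∀ p n Ω Λ j Λ' ω, j + 1 ≠ n → (θ'.Zh p n Ω Λ).quad j Λ' ω = (θ.Zh p n Ω Λ).quad j Λ' ω) ∧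
      ((∀ p n Ω Λ, (θ.Zh p n Ω Λ).LocalLaws) → ∀ p n Ω Λ, (θ'.Zh p n Ω Λ).LocalLaws) ∧
      ((∀ p n Ω Λ, (θ.Zh p n Ω Λ).Laws) → ∀ p n Ω Λ, (θ'.Zh p n Ω Λ).Laws) ∧
      (θ.ZhUnity → θ'.ZhUnity) ∧
      ∀ (p : B12.RunParams) (k : ℕ), 0 ≤ θ.s2.lf.E₀ → 0 ≤ θ.s2.lf.B₀ → (∀ j, j ≤ k + 1 → 0 ≤ gOfRecord₁₃ F N θ.toStage13Params p j) →
        (∀ (s : SeqOfRecord F θ.ν θ.τ9.M (gOfRecord₁₃ F N θ.toStage13Params p) p.K (k + 1)) (V : GaugeField (F.P p.K) (k + 1) (SU N)),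
          0 ≤ slotsOfRecord F N θ.ν θ.τ9 (EOfRecord₁₃ F N θ.toStage13Params) (wOfRecord₉ F N θ.toStage9Params) θ.ppSel p (gOfRecord₁₃ F N θ.toStage13Params p) (k + 1) s V) →
        (∀ s : SeqOfRecord F θ.ν θ.τ9.M (gOfRecord₁₃ F N θ.toStage13Params p) p.K (k + 1),
          ∀ᵐ V ∂fieldMeasure (F.P p.K) (k + 1) (SU N), chiSeqOfRecord F N θ.ν θ.τ9.M (gOfRecord₁₃ F N θ.toStage13Params p) p.K (k + 1) s V ≠ 0 →
            0 < slotsOfRecord F N θ.ν θ.τ9 (EOfRecord₁₃ F N θ.toStage13Params) (wOfRecord₉ F N θ.toStage9Params) θ.ppSel p (gOfRecord₁₃ F N θ.toStage13Params p) (k + 1) s V →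
            0 < sect2Slot F N (FluctV N) p.K (settingOfRecord₁₃ F N θ.toStage13Params p) (θ.rzAt p s)
              { WtOfRecord₁₃H F N θ p s with ζ := fun j Y ω => if j = k then 1 else (WtOfRecord₁₃H F N θ p s).ζ j Y ω } s Sect2.TermValues.zero (e p)
              (UbgOfRecord₁₃CoP F N θ.toStage13Params p (k + 1) s) V) →
        SLaw₁₃CoPH F N θ' p (k + 1) := by
  classical
  let T : (p : B12.RunParams) → (k : ℕ) → SeqOfRecord F θ.ν θ.τ9.M (gOfRecord₁₃ F N θ.toStage13Params p) p.K (k + 1) → GaugeField (F.P p.K) (k + 1) (SU N) → ℝ :=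
    fun p k s V => slotsOfRecord F N θ.ν θ.τ9 (EOfRecord₁₃ F N θ.toStage13Params) (wOfRecord₉ F N θ.toStage9Params) θ.ppSel p (gOfRecord₁₃ F N θ.toStage13Params p) (k + 1) s V
  let J : (p : B12.RunParams) → (k : ℕ) → SeqOfRecord F θ.ν θ.τ9.M (gOfRecord₁₃ F N θ.toStage13Params p) p.K (k + 1) → GaugeField (F.P p.K) (k + 1) (SU N) → ℝ :=
    fun p k s V => sect2Slot F N (FluctV N) p.K (settingOfRecord₁₃ F N θ.toStage13Params p) (θ.rzAt p s)
      { WtOfRecord₁₃H F N θ p s with ζ := fun j Y ω => if j = k then 1 else (WtOfRecord₁₃H F N θ p s).ζ j Y ω } s Sect2.TermValues.zero (e p)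
      (UbgOfRecord₁₃CoP F N θ.toStage13Params p (k + 1) s) V
  let G : (p : B12.RunParams) → (n : ℕ) → (ℕ → Set (Site (F.P p.K) 0)) → (ℕ → Set (Site (F.P p.K) 0)) → Set (GaugeField (F.P p.K) n (SU N)) := fun p n Ω Λ =>
    match n with
    | 0 => ∅
    | k + 1 => {V | ∃ s : SeqOfRecord F θ.ν θ.τ9.M (gOfRecord₁₃ F N θ.toStage13Params p) p.K (k + 1), s.Ω = Ω ∧ s.Λ = Λ ∧ 0 < T p k s V ∧ 0 < J p k s V}
  let c : (p : B12.RunParams) → (n : ℕ) → (ℕ → Set (Site (F.P p.K) 0)) → (ℕ → Set (Site (F.P p.K) 0)) → GaugeField (F.P p.K) n (SU N) → ℝ := fun p n Ω Λ =>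
    match n with
    | 0 => fun _ => 0
    | k + 1 => fun V => if h : ∃ s : SeqOfRecord F θ.ν θ.τ9.M (gOfRecord₁₃ F N θ.toStage13Params p) p.K (k + 1), s.Ω = Ω ∧ s.Λ = Λ then
        2 * Real.log (J p k h.choose V / T p k h.choose V) else 0
  let Yo : (p : B12.RunParams) → ℕ → (ℕ → Set (Site (F.P p.K) 0)) → Set (Site (F.P p.K) 0) := fun p n Ω => if (Ω n)ᶜ = (∅ : Set (Site (F.P p.K) 0)) then Set.univ else ∅
  let R : (p : B12.RunParams) → (n : ℕ) → (ℕ → Set (Site (F.P p.K) 0)) → (ℕ → Set (Site (F.P p.K) 0)) → GaugeField (F.P p.K) n (SU N) → Set (Site (F.P p.K) 0) :=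
    fun p n Ω Λ V => if V ∈ G p n Ω Λ then (Ω n)ᶜ else Yo p n Ω
  have hYo : ∀ p n (Ω : ℕ → Set (Site (F.P p.K) 0)), (Ω n)ᶜ ≠ Yo p n Ω := fun p n Ω h => by
    by_cases he : (Ω n)ᶜ = (∅ : Set (Site (F.P p.K) 0))
    · have h' : (Ω n)ᶜ = Set.univ := by rw [h]; exact if_pos he
      exact Set.empty_ne_univ (he.symm.trans h')
    · exact he (h.trans (if_neg he))
  let Zh' : (p : B12.RunParams) → ℕ → (ℕ → Set (Site (F.P p.K) 0)) → (ℕ → Set (Site (F.P p.K) 0)) → TkResidualW F N (FluctV N) p.K := fun p n Ω Λ =>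
    ⟨fun j Y ω => if j + 1 = n then Set.indicator {R p n Ω Λ (ω n).1} (1 : Set (Site (F.P p.K) 0) → ℝ) Y else (θ.Zh p n Ω Λ).ζ0 j Y ω,
      fun j Λ' ω => if j + 1 = n then (θ.Zh p n Ω Λ).quad j Λ' ω + c p n Ω Λ (ω n).1 else (θ.Zh p n Ω Λ).quad j Λ' ω⟩
  let θ' : Stage13HParams F N := { θ with Zh := Zh' }
  have hζ' : ∀ p n Ω Λ j Y ω, (θ'.Zh p n Ω Λ).ζ0 j Y ω =
      if j + 1 = n then Set.indicator {R p n Ω Λ (ω n).1} (1 : Set (Site (F.P p.K) 0) → ℝ) Y else (θ.Zh p n Ω Λ).ζ0 j Y ω := fun _ _ _ _ _ _ _ => rfl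
  have hq' : ∀ p n Ω Λ j Λ' ω, (θ'.Zh p n Ω Λ).quad j Λ' ω =
      if j + 1 = n then (θ.Zh p n Ω Λ).quad j Λ' ω + c p n Ω Λ (ω n).1 else (θ.Zh p n Ω Λ).quad j Λ' ω := fun _ _ _ _ _ _ _ => rfl
  refine ⟨θ', rfl, rfl, fun p n Ω Λ j Y ω hj => by rw [hζ', if_neg hj], fun p n Ω Λ j Λ' ω hj => by rw [hq', if_neg hj], zhLocal_of_repinTop hζ',
    zhLaws_of_repinTop hζ', zhUnity_of_repinTop hζ', fun p k hE₀ hB₀ hg hT0 hJ => ?_⟩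
  refine (sLaw₁₃CoPH_iff F N θ' p (k + 1)).2 ⟨fun _ => Sect2.TermValues.zero, fun _ => e p, Sect2.universalE_const _, fun s => ⟨?_, Or.inr ?_⟩⟩
  · exact Sect2.lawsRT_towerOfTerms_zero _ _ _ _ (k + 1) (settingOfRecord₁₃_satisfiesRG F N θ.toStage13Params p (k + 1)) hE₀ hB₀ hg
  -- at the history `s` of length `k+1`
  have hne : ∀ j, j < k → j + 1 ≠ k + 1 := fun j hj h => (Nat.ne_of_lt hj) (Nat.succ_injective h)
  have hex : ∃ s₀ : SeqOfRecord F θ.ν θ.τ9.M (gOfRecord₁₃ F N θ.toStage13Params p) p.K (k + 1), s₀.Ω = s.Ω ∧ s₀.Λ = s.Λ := ⟨s, rfl, rfl⟩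
  have hch : hex.choose = s := Seq.ext' hex.choose_spec.1 hex.choose_spec.2
  have hG : ∀ V, V ∈ G p (k + 1) s.Ω s.Λ ↔ 0 < T p k s V ∧ 0 < J p k s V := fun V => by
    show (∃ s₀ : SeqOfRecord F θ.ν θ.τ9.M (gOfRecord₁₃ F N θ.toStage13Params p) p.K (k + 1), s₀.Ω = s.Ω ∧ s₀.Λ = s.Λ ∧ 0 < T p k s₀ V ∧ 0 < J p k s₀ V) ↔ _
    exact ⟨fun ⟨s₀, hsΩ, hsΛ, hs⟩ => by rw [Seq.ext' hsΩ hsΛ] at hs; exact hs, fun h => ⟨s, rfl, rfl, h⟩⟩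
  have hζlt : ∀ j, j < k → (WtOfRecord₁₃H F N θ' p s).ζ j (s.Ω (j + 1))ᶜ = (WtOfRecord₁₃H F N θ p s).ζ j (s.Ω (j + 1))ᶜ := fun j hj => by
    funext ω
    rw [WtOfRecord₁₃H_ζ_eq_ζ0, WtOfRecord₁₃H_ζ_eq_ζ0, hζ', if_neg (hne j hj)]
  have hwlt : ∀ j, j < k → ∀ S₁, (WtOfRecord₁₃H F N θ' p s).w j (s.Λ (j + 1)) ((s.Λ (j + 1))ᶜ ∩ s.Ω (j + 1)) S₁ =
      (WtOfRecord₁₃H F N θ p s).w j (s.Λ (j + 1)) ((s.Λ (j + 1))ᶜ ∩ s.Ω (j + 1)) S₁ := fun j hj S₁ => by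
    funext ω
    show chiAW F N (FluctV N) θ.ν θ.A₁ p (gOfRecord₁₃ F N θ.toStage13Params p) j ((s.Λ (j + 1))ᶜ ∩ s.Ω (j + 1)) S₁ ω * Real.exp (-(1 / 2 : ℝ) * (θ'.Zh p (k + 1) s.Ω s.Λ).quad j (s.Λ (j + 1)) ω) =
      chiAW F N (FluctV N) θ.ν θ.A₁ p (gOfRecord₁₃ F N θ.toStage13Params p) j ((s.Λ (j + 1))ᶜ ∩ s.Ω (j + 1)) S₁ ω * Real.exp (-(1 / 2 : ℝ) * (θ.Zh p (k + 1) s.Ω s.Λ).quad j (s.Λ (j + 1)) ω)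
    rw [hq', if_neg (hne j hj)]
  have hζ : ∀ ω, (WtOfRecord₁₃H F N θ' p s).ζ k (s.Ω (k + 1))ᶜ ω = Set.indicator {V | 0 < T p k s V ∧ 0 < J p k s V} (1 : GaugeField (F.P p.K) (k + 1) (SU N) → ℝ) (ω (k + 1)).1 := by
    intro ω
    rw [WtOfRecord₁₃H_ζ_eq_ζ0, hζ', if_pos rfl]
    by_cases hV : 0 < T p k s (ω (k + 1)).1 ∧ 0 < J p k s (ω (k + 1)).1
    · have hRV : R p (k + 1) s.Ω s.Λ (ω (k + 1)).1 = (s.Ω (k + 1))ᶜ := if_pos ((hG _).2 hV)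
      rw [hRV, Set.indicator_of_mem (Set.mem_singleton _), Set.indicator_of_mem (show (ω (k + 1)).1 ∈ {V | 0 < T p k s V ∧ 0 < J p k s V} from hV),
        Pi.one_apply, Pi.one_apply]
    · have hRV : R p (k + 1) s.Ω s.Λ (ω (k + 1)).1 = Yo p (k + 1) s.Ω := if_neg (fun h => hV ((hG _).1 h))
      rw [hRV, Set.indicator_of_notMem (fun h => hYo p (k + 1) s.Ω (Set.mem_singleton_iff.1 h)),
        Set.indicator_of_notMem (show (ω (k + 1)).1 ∉ {V | 0 < T p k s V ∧ 0 < J p k s V} from hV)]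
  have hw : ∀ S₁ ω, (WtOfRecord₁₃H F N θ' p s).w k (s.Λ (k + 1)) ((s.Λ (k + 1))ᶜ ∩ s.Ω (k + 1)) S₁ ω =
      Real.exp (-(1 / 2 : ℝ) * c p (k + 1) s.Ω s.Λ (ω (k + 1)).1) * (WtOfRecord₁₃H F N θ p s).w k (s.Λ (k + 1)) ((s.Λ (k + 1))ᶜ ∩ s.Ω (k + 1)) S₁ ω := by
    intro S₁ ω
    show chiAW F N (FluctV N) θ.ν θ.A₁ p (gOfRecord₁₃ F N θ.toStage13Params p) k ((s.Λ (k + 1))ᶜ ∩ s.Ω (k + 1)) S₁ ω * Real.exp (-(1 / 2 : ℝ) * (θ'.Zh p (k + 1) s.Ω s.Λ).quad k (s.Λ (k + 1)) ω) =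
      Real.exp (-(1 / 2 : ℝ) * c p (k + 1) s.Ω s.Λ (ω (k + 1)).1) *
        (chiAW F N (FluctV N) θ.ν θ.A₁ p (gOfRecord₁₃ F N θ.toStage13Params p) k ((s.Λ (k + 1))ᶜ ∩ s.Ω (k + 1)) S₁ ω * Real.exp (-(1 / 2 : ℝ) * (θ.Zh p (k + 1) s.Ω s.Λ).quad k (s.Λ (k + 1)) ω))
    rw [hq', if_pos rfl, mul_add, Real.exp_add]
    ring
  have hc : ∀ V, 0 < T p k s V → 0 < J p k s V → c p (k + 1) s.Ω s.Λ V = 2 * Real.log (J p k s V / T p k s V) := fun V _ _ => by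
    show (if h : ∃ s₀ : SeqOfRecord F θ.ν θ.τ9.M (gOfRecord₁₃ F N θ.toStage13Params p) p.K (k + 1), s₀.Ω = s.Ω ∧ s₀.Λ = s.Λ then
      2 * Real.log (J p k h.choose V / T p k h.choose V) else 0) = _
    rw [dif_pos hex, hch]
  filter_upwards [hJ s] with V hV hχ
  exact target_eq_sect2Slot_of_switch_dial θ p s Sect2.TermValues.zero (e p) (WtOfRecord₁₃H F N θ' p s) (T p k s) (c p (k + 1) s.Ω s.Λ) hζlt hwlt hζ hw hc V
    (hT0 s V) (hV hχ)

end SLaws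

/-! ## §3. K1⁹'s (B) FACE: `B16.Thm1Printed` of the datum of record — «∃ γ > 0, along every run in the window, ∀ k ≤ K, the §2 form of `ρ_k`» — inside K1⁹'s hypothesis class,
from the signs and the per-history support conditions ALONE -/

section BFace

/-- ★★★★★★ **K1⁹'s (B)-FACE CONJUNCT `B16.Thm1Printed (datumOfRecord₁₃SepCoPH θ′ h′).C` HOLDS BY FIAT MODULO SUPPORTS.**  From ANY `θ` carrying K1⁹'s four hypothesis-side conjuncts
there is a `θ′` CARRYING THE SAME FOUR, with the SAME `Stage13RParams` data and `Phih` — hence the same densities `ρ_k`, flow, β-functions, averaged observables, (0.1)∕Cor. 3 faces — such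
that for EVERY `γ > 0`: the signs `0 ≤ E₀, B₀` and, along every run `P` in the `γ`-window and every step `k < K`, the per-history support condition (a.e. on the `χ_{k+1}(s)`-support:
`0 < ρ_{k+1}(s) → 0 < J⁰_P(s)`, `J⁰` = `θ`'s own new side with ZERO terms, constant `e_P`, top-generation residual factor `1`) ALONE give `B16.Thm1Printed (datumOfRecord₁₃SepCoPH F N θ′ h′).C`
— [V] Thm 1's «the densities `ρ_k`, `k ≤ K`, have the form and satisfy all the conditions and bounds of Sect. 2 [III]» AS TYPED, with witness `γ` and ZERO renormalization terms.  (The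
statement is version-free: `thm1Printed_datumOfRecord₁₃SepCoPHV_iff`.)  So the vacuity certified for the 𝐓-laws is NOT confined to the N11 consumer side: K1⁹'s own (B) face reads the
𝐒-laws through the same value-free residual slots.  LOCATED, count-neutral; nothing of Bałaban asserted or refuted; the support conditions are NOT claimed at any `θ`; K1⁹'s `∃θ` neither
advanced nor refuted (the antecedent's inhabitation, the supports, `Cor3_250` ∕ (0.1), the flow ∕ β conjuncts are untouched). [cite: Balaban1989LargeFieldII, Thm 1 p.355; Balaban1988Convergent, Thm 1 p.262, (2.17)–(2.18) p.257, (2.21)–(2.23) p.258, (3.23)–(3.25) p.270; Balaban1989LargeFieldI, (0.2)–(0.4) pp.176–177] -/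
theorem exists_thm1Printed_datum_by_fiat_of_supports_of_hypotheses (θ : Stage13HParams F N) (hP : θ.Provisos₁₃SepCoPH F N) (hU : θ.ZhUnity)
    (hS : θ.SlotsNondegenerate₁₃ F N) (hA : θ.Admissible F N) (e : B12.RunParams → ℝ) :
    ∃ (θ' : Stage13HParams F N) (h' : θ'.Provisos₁₃SepCoPH F N), θ'.toStage13RParams = θ.toStage13RParams ∧ θ'.Phih = θ.Phih ∧
      (θ'.ZhUnity ∧ θ'.SlotsNondegenerate₁₃ F N) ∧ θ'.Admissible F N ∧
      ∀ γ : ℝ, 0 < γ → 0 ≤ θ.s2.lf.E₀ → 0 ≤ θ.s2.lf.B₀ →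
        (∀ P : B12.RunParams, (settingOfRecord₁₃ F N θ.toStage13Params P).flow.InInterval γ P.K → ∀ k, k < P.K →
          ∀ s : SeqOfRecord F θ.ν θ.τ9.M (gOfRecord₁₃ F N θ.toStage13Params P) P.K (k + 1),
            ∀ᵐ V ∂fieldMeasure (F.P P.K) (k + 1) (SU N), chiSeqOfRecord F N θ.ν θ.τ9.M (gOfRecord₁₃ F N θ.toStage13Params P) P.K (k + 1) s V ≠ 0 →
              0 < slotsOfRecord F N θ.ν θ.τ9 (EOfRecord₁₃ F N θ.toStage13Params) (wOfRecord₉ F N θ.toStage9Params) θ.ppSel P (gOfRecord₁₃ F N θ.toStage13Params P) (k + 1) s V →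
              0 < sect2Slot F N (FluctV N) P.K (settingOfRecord₁₃ F N θ.toStage13Params P) (θ.rzAt P s)
                { WtOfRecord₁₃H F N θ P s with ζ := fun j Y ω => if j = k then 1 else (WtOfRecord₁₃H F N θ P s).ζ j Y ω } s Sect2.TermValues.zero (e P)
                (UbgOfRecord₁₃CoP F N θ.toStage13Params P (k + 1) s) V) →
        B16.Thm1Printed (datumOfRecord₁₃SepCoPH F N θ' h').C := by
  obtain ⟨θ', h1, h2, -, -, hloc, hlaws, hun, hsl⟩ := exists_zh_allSteps_sLaw_zeroTerms_of_supports θ e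
  have hP' : θ'.Provisos₁₃SepCoPH F N := provisos₁₃SepCoPH_of_sameR h1 hP (hlaws hP.zhLaws) (hloc hP.zhLocal)
  refine ⟨θ', hP', h1, h2, ⟨hun hU, slotsNondegenerate₁₃_of_sameR h1 hS⟩, admissible_of_sameR h1 hA, fun γ hγ hE₀ hB₀ hsupp => ⟨γ, hγ, fun P hI k hk => ?_⟩⟩
  refine (sect2Form_stage13SepCoPH_iff F N θ' hP' P k).2 ((sLaw₁₃CoPH_iff F N θ' P k).1 ?_)
  rcases k with _ | k
  · exact sLaw₁₃CoPH_zero F N θ' P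
  · have hI' : (settingOfRecord₁₃ F N θ.toStage13Params P).flow.InInterval γ P.K := by
      obtain ⟨R', Zh', Phih'⟩ := θ'
      cases h1
      exact hI
    exact hsl P k hE₀ hB₀ (fun j hj => (hI' j (hj.trans hk)).1.le) (fun s V => slotsOfRecord_nonneg_of_provisos₁₃CoPH θ P hP.toCore s V) (hsupp P hI' k hk)

end BFace


end Summit.QuantumFields.YangMills.Theorems.BalabanUVNodesN11K1BFaceSect2FormBySupports

end
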